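import Literature.AlgebraicGeometry.Resolution.ArithmeticalThreefoldsLocalPermissible
import Literature.AlgebraicGeometry.Resolution.ArithmeticalThreefoldsLocalInField
import Literature.AlgebraicGeometry.Resolution.QuadraticTransformsChart
import Literature.RingTheory.HilbertSamuel.NormalFlatnessRegularGenericPoint
import HarnessLib

/-!
# Cossart–Piltant 2019, local theorem in printed shape: the two renderings compared and the weak form derived

Topic: `Literature/AlgebraicGeometry/Resolution`. Companion (PROOFS only; no definitions, no named
facts) of `ArithmeticalThreefoldsLocalPermissible.lean`, which carries the NAMED FACTS
`CossartPiltant2019LocalPermissible` (Cossart–Piltant 2019 journal Thm. 1.5 = arXiv v1 Thm. 1.4 as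
a finite tower of local Hironaka-permissible blowing ups along `μ` ending regular, the centre clause
read as "regular centre along which the ring is normally flat", the authors' gloss p. 3) and
`CossartPiltant2019LocalPermissibleSing` (the same with the centre clause read flatness-free through
p. 9, "`Sing 𝒳 = {m ≥ 2}`": at a singular stage the generic point of the centre is singular).
PROVED here:

* `localPermissibleSing_of_localPermissible` — the normally-flat rendering implies the
  flatness-free one: the members of the tower are Noetherian local rings (localisations of finitely
  generated extensions, by induction), and Bennett's theorem in the tree's ring-level form
  (`Literature.RingTheory.HilbertSamuel.not_isRegularLocalRing_localization_of_isNormallyFlat`: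
  a normally flat regular centre through a singular point has singular generic point) converts the
  clause.
* `CossartPiltant2019Local.of_localPermissibleSing`, `CossartPiltant2019Local.of_localPermissible`
  — either printed-shape rendering implies the WEAK local-uniformization fact already in the tree,
  `CossartPiltant2019Local` (`ArithmeticalThreefoldsLocal.lean`), through its in-field reduction
  `CossartPiltant2019Local.of_inField` and the tower lemma `exists_fg_regular_of_tower`
  (`LocalBlowup.lean`, Novacoski–Spivakovsky Lemma 2.9 / Def. 2.20). So both new facts sit ABOVE
  the old one in the decomposition `cossartPiltant2019_of_local`.
* small tower bookkeeping: `reflTransGen_isLocalBlowup_of_tower` (and private Noetherianity helpers).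

## Sources

* V. Cossart, O. Piltant, J. Algebra 529 (2019) 268–535 = arXiv:1412.0868, Thm. 1.4 (v1 p. 4),
  §2.1 (v1 p. 9), Def. 2.7 and §2.2 (v1 p. 14), p. 3. [CossartPiltant2019]
* V. Cossart, U. Jannsen, S. Saito, LNM 2270 (2020), Thm. 3.3. [CossartJannsenSaito2020]
* J. Novacoski, M. Spivakovsky, arXiv:1204.4751, Def. 2.11, Lemma 2.9, Def. 2.20.
  [NovacoskiSpivakovsky2014]
-/

noncomputable section

open IsLocalRing Polynomial

namespace Literature.AlgebraicGeometry.Resolution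

universe u

section Proofs

variable {L : Type u} [Field L]

/-- A tower `B 0 → B 1 → ⋯ → B r` of local blowing ups along ideals with respect to `O` is a tower
of local blowing ups (`Relation.ReflTransGen (IsLocalBlowup O)`). [cite: NovacoskiSpivakovsky2014, Def. 2.11] -/
theorem reflTransGen_isLocalBlowup_of_tower {O : ValuationSubring L} (B : ℕ → Subring L) (r : ℕ)
    (hB : ∀ i < r, ∃ P : Ideal (B i), IsLocalBlowupAlong O (B i) P (B (i + 1))) :
    Relation.ReflTransGen (IsLocalBlowup O) (B 0) (B r) := by
  induction r with
  | zero => exact Relation.ReflTransGen.refl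
  | succ r ih =>
    refine Relation.ReflTransGen.tail (ih fun i hi => hB i (Nat.lt_succ_of_lt hi)) ?_
    obtain ⟨P, hP⟩ := hB r (Nat.lt_succ_self r)
    exact hP.isLocalBlowup

/-- `B_{𝔪_O ∩ B}` is Noetherian when `B ⊆ O` is. [folklore] -/
private theorem isNoetherianRing_locAtCentre {B : Subring L} {O : ValuationSubring L} (h : B ≤ O.toSubring)
    [IsNoetherianRing B] : IsNoetherianRing (locAtCentre B O) :=
  isNoetherianRing_of_ringEquiv (R := Localization.AtPrime (subringCentre B O h))
    (locAtCentreEquiv h).toRingEquiv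

/-- `B[t]` (a finite set `t` adjoined inside `L`) is Noetherian when `B` is. [folklore] -/
private theorem isNoetherianRing_closure_union_finset (B : Subring L) [IsNoetherianRing B] (t : Finset L) :
    IsNoetherianRing (Subring.closure ((B : Set L) ∪ ↑t)) := by
  have e : Subring.closure ((B : Set L) ∪ ↑t) = (Algebra.adjoin B (t : Set L)).toSubring := by
    rw [Algebra.adjoin_eq_ring_closure]
    congr 1
    ext z
    simp only [Set.mem_union, SetLike.mem_coe, Set.mem_range]
    constructor
    · rintro (hz | hz)
      · exact Or.inl ⟨⟨z, hz⟩, rfl⟩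
      · exact Or.inr hz
    · rintro (⟨w, rfl⟩ | hz)
      · exact Or.inl w.2
      · exact Or.inr hz
  rw [e]
  exact isNoetherianRing_of_fg (Subalgebra.fg_adjoin_finset t)

/-- The target of a local blowing up of a Noetherian `B ⊆ O` is Noetherian. [folklore] -/
private theorem IsLocalBlowup.isNoetherianRing {O : ValuationSubring L} {B B' : Subring L}
    (H : IsLocalBlowup O B B') [IsNoetherianRing B] : IsNoetherianRing B' := by
  obtain ⟨hB, t, ht, rfl⟩ := H
  haveI := isNoetherianRing_closure_union_finset B t
  exact isNoetherianRing_locAtCentre (Subring.closure_le.mpr (Set.union_subset hB ht))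

/-- **The normally-flat rendering implies the flatness-free one** (Bennett: a normally flat
regular centre through a SINGULAR point of a Noetherian local ring has singular generic point,
`Literature.RingTheory.HilbertSamuel.not_isRegularLocalRing_localization_of_isNormallyFlat`; the
members of the tower are Noetherian local rings). [cite: CossartJannsenSaito2020, Thm. 3.3] [folklore] -/
theorem localPermissibleSing_of_localPermissible (H : CossartPiltant2019LocalPermissible.{u}) :
    CossartPiltant2019LocalPermissibleSing.{u} := by
  intro p hp L _ R _ hexc hdim hchar h x hmon hdeg hx hmin hgen hcase O hRO hdom
  classical
  obtain ⟨r, B, hB0, hstep, hreg⟩ :=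
    H p hp L R hexc hdim hchar h x hmon hdeg hx hmin hgen hcase O hRO hdom
  refine ⟨r, B, hB0, fun i hi => ?_, hreg⟩
  obtain ⟨P, hPreg, hNF, hP⟩ := hstep i hi
  -- `B i` is a Noetherian local ring: by induction along the tower from `B 0 = R[x]_{𝔪_O ∩ R[x]}`
  have hxO : x ∈ O := by
    have hint : IsIntegral R x := ⟨h, hmon, by rwa [aeval_def] at hx⟩
    letI : Algebra R O := (Subring.inclusion hRO).toAlgebra
    haveI : IsScalarTower R O L := IsScalarTower.of_algebraMap_eq (fun _ => rfl)
    have hint' : IsIntegral O x := hint.tower_top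
    obtain ⟨y, rfl⟩ := IsIntegrallyClosed.algebraMap_eq_of_integral hint'
    exact y.2
  have hAO : (Algebra.adjoin R ({x} : Set L)).toSubring ≤ O.toSubring := by
    rw [Algebra.adjoin_eq_ring_closure]
    refine Subring.closure_le.mpr (Set.union_subset ?_ (Set.singleton_subset_iff.mpr hxO))
    rintro _ ⟨s, rfl⟩
    exact hRO s.2
  have hNoethLoc : ∀ j ≤ r, IsNoetherianRing (B j) ∧ IsLocalRing (B j) := by
    intro j hj
    induction j with
    | zero =>
      rw [hB0]
      haveI := isNoetherianRing_adjoin_toSubring R x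
      exact ⟨isNoetherianRing_locAtCentre hAO, isLocalRing_locAtCentre hAO⟩
    | succ j ih =>
      obtain ⟨Q, -, -, hQ⟩ := hstep j (Nat.lt_of_succ_le hj)
      haveI := (ih (Nat.le_of_succ_le hj)).1
      exact ⟨hQ.isLocalBlowup.isNoetherianRing, hQ.isLocalBlowup.isLocalRing⟩
  haveI := (hNoethLoc i hi.le).1
  haveI := (hNoethLoc i hi.le).2
  haveI := hPreg
  haveI : IsDomain (B i ⧸ P) := isDomain_of_isRegularLocalRing (B i ⧸ P)
  haveI : P.IsPrime := (Ideal.Quotient.isDomain_iff_prime P).mp inferInstance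
  exact ⟨P, inferInstance, hPreg,
    fun hsing => Literature.RingTheory.HilbertSamuel.not_isRegularLocalRing_localization_of_isNormallyFlat
      hsing P hNF, hP⟩

/-- **The printed shape implies the weak local-uniformization form** (`CossartPiltant2019Local`,
through its in-field reduction `CossartPiltant2019Local.of_inField`): a tower of local blowing ups
with respect to `O` starting at `R[x]_{𝔪_O ∩ R[x]}` and ending with a regular local ring yields a
finite `t ⊆ L` with `R[x][t] ⊆ O` regular at the centre (`exists_fg_regular_of_tower`).
[cite: CossartPiltant2019, Thm. 1.5 (arXiv v1: Thm. 1.4)] [cite: NovacoskiSpivakovsky2014, Lemma 2.9, Def. 2.20] -/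
theorem CossartPiltant2019Local.of_localPermissibleSing (H : CossartPiltant2019LocalPermissibleSing.{u}) :
    CossartPiltant2019Local.{u} := by
  refine CossartPiltant2019Local.of_inField ?_
  intro p hp L _ R _ hexc hdim hchar h x hmon hdeg hx hmin hgen hcase O hRO hdom
  classical
  obtain ⟨r, B, hB0, hstep, hreg⟩ :=
    H p hp L R hexc hdim hchar h x hmon hdeg hx hmin hgen hcase O hRO hdom
  -- `R[x] ⊆ O`: `x` is integral over `R ⊆ O` and `O` is integrally closed in `L`
  set A : Subring L := (Algebra.adjoin R ({x} : Set L)).toSubring with hA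
  have hxO : x ∈ O := by
    have hint : IsIntegral R x := ⟨h, hmon, by rwa [aeval_def] at hx⟩
    letI : Algebra R O := (Subring.inclusion hRO).toAlgebra
    haveI : IsScalarTower R O L := IsScalarTower.of_algebraMap_eq (fun _ => rfl)
    have hint' : IsIntegral O x := hint.tower_top
    obtain ⟨y, rfl⟩ := IsIntegrallyClosed.algebraMap_eq_of_integral hint'
    exact y.2
  have hAO : A ≤ O.toSubring := by
    rw [hA, Algebra.adjoin_eq_ring_closure]
    refine Subring.closure_le.mpr (Set.union_subset ?_ (Set.singleton_subset_iff.mpr hxO))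
    rintro _ ⟨s, rfl⟩
    exact hRO s.2
  -- the tower `A → B 0 → ⋯ → B r` is one local blowing up of `A`
  have htower : ∀ n ≤ r, IsLocalBlowup O A (B n) := by
    intro n hn
    induction n with
    | zero => rw [hB0]; exact IsLocalBlowup.locAtCentre_self hAO
    | succ n ih =>
      obtain ⟨P, _, -, -, hP⟩ := hstep n (Nat.lt_of_succ_le hn)
      exact (ih (Nat.le_of_succ_le hn)).trans hP.isLocalBlowup
  have hBr : IsLocalBlowup O A (B r) := htower r le_rfl
  obtain ⟨t, ht, hreg'⟩ := exists_fg_regular_of_tower hAO (Relation.ReflTransGen.single hBr)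
    hBr.locAtCentre_eq hreg
  -- `A[t] = R[x, t]`
  have e : Subring.closure ((A : Set L) ∪ ↑t) =
      (Algebra.adjoin R (insert x (t : Set L))).toSubring := by
    apply le_antisymm
    · refine Subring.closure_le.mpr (Set.union_subset ?_ ?_)
      · rw [hA]
        exact Algebra.adjoin_mono (Set.singleton_subset_iff.mpr (Set.mem_insert x _))
      · exact (Set.subset_insert x _).trans Algebra.subset_adjoin
    · rw [Algebra.adjoin_eq_ring_closure]
      refine Subring.closure_le.mpr (Set.union_subset ?_ ?_)
      · rintro _ ⟨s, rfl⟩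
        exact Subring.subset_closure (Or.inl (by rw [hA]; exact Subalgebra.algebraMap_mem _ s))
      · rintro z hz
        rcases Set.mem_insert_iff.mp hz with rfl | hz
        · exact Subring.subset_closure (Or.inl (by rw [hA]; exact Algebra.self_mem_adjoin_singleton R z))
        · exact Subring.subset_closure (Or.inr hz)
  have ht' : (Algebra.adjoin R (insert x (t : Set L))).toSubring ≤ O.toSubring := e ▸ ht
  exact ⟨t, ht', (isRegularLocalRing_centre_congr e ht ht').mp hreg'⟩

/-- The normally-flat rendering implies the weak form too. [cite: CossartPiltant2019, Thm. 1.5 (arXiv v1: Thm. 1.4)] -/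
theorem CossartPiltant2019Local.of_localPermissible (H : CossartPiltant2019LocalPermissible.{u}) :
    CossartPiltant2019Local.{u} :=
  CossartPiltant2019Local.of_localPermissibleSing (localPermissibleSing_of_localPermissible H)

end Proofs

end Literature.AlgebraicGeometry.Resolution

end
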